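import Summits.AtomisticToContinuum.Crystallization.Theorems.PalmUnimodularRigidityLayeredLawsSelectHcpDefs
import Summits.AtomisticToContinuum.Crystallization.Theorems.LayeredLawsSelectHcp.Negative.RootedRedundant
import Summits.AtomisticToContinuum.Crystallization.Theorems.PalmUnimodularRigidityMinimiserShellsEquilibriumInLaw

/-!
# Crux `LayeredLawsSelectHcp` (stmt-AtomisticToContinuum-9226), line `mtp-prestress-split-ergodic-frame`:
# minimising layered laws are almost surely Sütő `μ`-ground-state configurations at `μ = e*`

Registered sub-goal `tube_ae_isMuGSC` of the crux item (serves both remaining stubs of the line,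
`stub_tubeRigidity` — the rigidity half — and `stub_haggSelection` — the selection half): for every
MINIMISING (`E_P[h] ≤ e*`) point-stationary probability law `P` that is LAYERED (a.s. `count|S`, every point of
`S` with a `(1/100)`-good shell, `S` Barlow-like), `P`-almost every sample is the counting measure of a Sütő
`μ`GSC of Lennard-Jones at chemical potential `μ = e*` (`IsMuGSC lennardJones eStar S`): no finite modification
"remove `n` atoms, insert `k` atoms" lowers `U − e*·#`.  In particular almost every sample is in force balance
and is optimal against every finite rearrangement — the deterministic first-order structure any proof of the
energy floor / zero-defect stub starts from.

Proof: the LANDED theorem of the sibling crux `MinimiserShells`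
(`PalmUnimodularRigidityMinimiserShells.EquilibriumInLaw.ae_forall_gainCount_eq_zero` + `isMuGSC_of_dense`, the
body of `stub_equilibriumInLaw` without its unused route hypothesis) applied with the hard core `δ = 891/1000`
that layered laws have for free (`Negative.RootedRedundant.rooted_of_pointStationary_layered`: good shells
separate, the Mecke identity roots).  The two routes' inlined `meanRootEnergy` / `eStar` / point-stationarity
predicates agree definitionally.  [folklore]
-/

noncomputable section

open MeasureTheory
open scoped ENNReal BigOperators

namespace Summit.AtomisticToContinuum.Crystallization.Theorems.PalmUnimodularRigidity.LayeredLawsSelectHcp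

open Literature.Probability.Process (IsPointStationaryLaw IsRootedHardCore)
open Literature.MathematicalPhysics.StatisticalMechanics (lennardJones IsMuGSC UniformlyDiscrete)
open Summit.AtomisticToContinuum.Crystallization.Theorems.ChargedEnergyGapNegative (eStar)
open Summit.AtomisticToContinuum.Crystallization.Theorems.LayeredLawsSelectHcp.Negative.DiracLaws
  (PointStationary meanRootEnergy Layered)
open Summit.AtomisticToContinuum.Crystallization.Theorems.LayeredLawsSelectHcp.Negative.RootedRedundant
  (rooted_of_pointStationary_layered)
open Summit.AtomisticToContinuum.Crystallization.Theorems.PalmUnimodularRigidityMinimiserShells.EquilibriumInLaw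
  (denseRange_ratPt ae_forall_gainCount_eq_zero)
open Summit.AtomisticToContinuum.Crystallization.Theorems.PalmUnimodularRigidityMinimiserShells.EquilibriumInLaw.Countable
  (isMuGSC_of_dense)
open Summit.AtomisticToContinuum.Crystallization.Theorems.PalmUnimodularRigidityMinimiserShells.EquilibriumInLaw.GainEvent
  (gainCount_ne_zero_of_gain)

/-- Euclidean `3`-space. [folklore] -/
local notation "E3" => EuclideanSpace ℝ (Fin 3)

/-- A layered point-stationary law is almost surely a rooted `891/1000`-hard-core configuration
(`rooted_of_pointStationary_layered`, read as `IsRootedHardCore`). [folklore] -/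
theorem ae_isRootedHardCore_of_layered {P : Measure (Measure E3)} (h2 : PointStationary P) (h4 : Layered P) :
    ∀ᵐ μ ∂P, IsRootedHardCore (891 / 1000) μ :=
  rooted_of_pointStationary_layered h2 h4

/-- The sibling crux's minimality-to-`μ`GSC theorem, unconditional form (the body of
`EquilibriumInLaw.stub_equilibriumInLaw` without its unused `UnimodularEnergyLowerBound` hypothesis): a
minimising point-stationary `δ`-hard-core probability law is a.s. carried by Sütő `μ`GSCs of Lennard-Jones at
`μ = e*`. [folklore] -/
theorem ae_isMuGSC_of_hardCore {δ : ℝ} (hδ : 0 < δ) {P : Measure (Measure E3)} [IsProbabilityMeasure P]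
    (hcore : ∀ᵐ μ ∂P, IsRootedHardCore δ μ) (hstat : IsPointStationaryLaw P)
    (hE : MinimiserShells.Negative.LoadBearing.meanRootEnergy P ≤ MinimiserShells.Negative.LoadBearing.eStar) :
    ∀ᵐ μ ∂P, ∃ S : Set E3, μ = (Measure.count : Measure E3).restrict S ∧
      IsMuGSC lennardJones MinimiserShells.Negative.LoadBearing.eStar S := by
  filter_upwards [hcore, ae_forall_gainCount_eq_zero hδ hcore hstat hE] with μ hμ hall
  obtain ⟨S, -, hsep, rfl⟩ := hμ
  refine ⟨S, rfl, ?_⟩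
  refine isMuGSC_of_dense (⟨δ, hδ, hsep⟩ : UniformlyDiscrete S) denseRange_ratPt
    fun n xf hxf hxX k R hRQ hR hdisj => ?_
  -- the inserted configuration has rational coordinates
  choose q hq using hRQ
  obtain rfl : R = fun i => (EuclideanSpace.equiv (Fin 3) ℝ).symm fun c => (q i c : ℝ) :=
    funext fun i => (hq i).symm
  -- suppose the inequality fails by a margin `> 1/(j+1)` and bound all points by an integer `r`
  by_contra hlt
  rw [not_le] at hlt
  obtain ⟨j, hj⟩ := exists_nat_one_div_lt (sub_pos.2 hlt)
  set r : ℕ := ⌈∑ l, ‖xf l‖ + ∑ i, ‖(EuclideanSpace.equiv (Fin 3) ℝ).symm (fun c => (q i c : ℝ))‖⌉₊ with hr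
  have hrsum : ∑ l, ‖xf l‖ + ∑ i, ‖(EuclideanSpace.equiv (Fin 3) ℝ).symm (fun c => (q i c : ℝ))‖ ≤ (r : ℝ) :=
    Nat.le_ceil _
  have hxr : ∀ l, ‖xf l‖ ≤ (r : ℝ) := fun l => by
    have h1 : ‖xf l‖ ≤ ∑ l, ‖xf l‖ :=
      Finset.single_le_sum (f := fun l => ‖xf l‖) (fun _ _ => norm_nonneg _) (Finset.mem_univ l)
    have h2 : (0 : ℝ) ≤ ∑ i, ‖(EuclideanSpace.equiv (Fin 3) ℝ).symm (fun c => (q i c : ℝ))‖ :=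
      Finset.sum_nonneg fun _ _ => norm_nonneg _
    linarith
  have hRr : ∀ i, ‖(EuclideanSpace.equiv (Fin 3) ℝ).symm (fun c => (q i c : ℝ))‖ ≤ (r : ℝ) := fun i => by
    have h1 : ‖(EuclideanSpace.equiv (Fin 3) ℝ).symm (fun c => (q i c : ℝ))‖ ≤
        ∑ i, ‖(EuclideanSpace.equiv (Fin 3) ℝ).symm (fun c => (q i c : ℝ))‖ :=
      Finset.single_le_sum (f := fun i => ‖(EuclideanSpace.equiv (Fin 3) ℝ).symm (fun c => (q i c : ℝ))‖)
        (fun _ _ => norm_nonneg _) (Finset.mem_univ i)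
    have h2 : (0 : ℝ) ≤ ∑ l, ‖xf l‖ := Finset.sum_nonneg fun _ _ => norm_nonneg _
    linarith
  have hgain := gainCount_ne_zero_of_gain (ε := 1 / ((j : ℝ) + 1)) hδ hsep xf hxf hxX hxr hR hRr hdisj
    (by linarith)
  exact hgain (hall n k r j q)

/-- **Registered sub-goal `tube_ae_isMuGSC` (serves `stub_tubeRigidity` and `stub_haggSelection`).**  Every
minimising point-stationary LAYERED probability law is almost surely carried by Sütő `μ`-ground-state
configurations of Lennard-Jones at `μ = e*`: the hard core comes from the good shells
(`rooted_of_pointStationary_layered`), the rest is the sibling crux's equilibrium-in-law theorem.  The crux's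
`PointStationary` / `meanRootEnergy` / `eStar` (route `PalmUnimodularRigidity`, `Negative.DiracLaws`) and the
`MinimiserShells` line's `IsPointStationaryLaw` / `LoadBearing.meanRootEnergy` / `LoadBearing.eStar` are the same
terms. [folklore] -/
theorem tube_ae_isMuGSC :
    ∀ P : Measure (Measure E3), IsProbabilityMeasure P → PointStationary P → meanRootEnergy P ≤ eStar →
      Layered P → ∀ᵐ μ ∂P, ∃ S : Set E3, μ = (Measure.count : Measure E3).restrict S ∧
        IsMuGSC lennardJones eStar S :=
  fun _ _ h2 h3 h4 =>
    -- the two routes' `eStar` / `meanRootEnergy` are the same terms (definitional unfolding)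
    ae_isMuGSC_of_hardCore (by norm_num) (ae_isRootedHardCore_of_layered h2 h4) h2 h3

/-- Read-back: the two inlined thresholds agree definitionally. [folklore] -/
example : (eStar : ℝ) = MinimiserShells.Negative.LoadBearing.eStar := rfl

end Summit.AtomisticToContinuum.Crystallization.Theorems.PalmUnimodularRigidity.LayeredLawsSelectHcp

end
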